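import Summits.BirchSwinnertonDyer.Rank1Residual.X11b.KolyvaginHlocConcrete
import Summits.BirchSwinnertonDyer.Rank1Residual.X11b.KolyvaginHGZOfKodairaNeronRat
import Summits.BirchSwinnertonDyer.Rank1Residual.X11b.KolyvaginHGZOfGross1991
import Summits.BirchSwinnertonDyer.Rank1Residual.JET.KolyvaginClassSignUnconditional
import Summits.BirchSwinnertonDyer.Rank1Residual.JET.ZhangKolyvaginPrimeGross
import Summits.BirchSwinnertonDyer.BirchSwinnertonDyer.Theorems.KolyvaginRoadThreeLevelData
import Literature.NumberTheory.EllipticCurves.McCallum1991.KolyvaginClassesLocalLeaves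
import Literature.NumberTheory.EllipticCurves.HeegnerPointsKolyvaginClassesPointsProofs
import HarnessLib

/-!
# Route `KolyvaginDepthDoor`, crux `KolyvaginDepthSupply` (stmt-BirchSwinnertonDyer-21765) —
# LEAF 2 OF THE hF-FREE DOOR AT LEVEL `p`: McCallum 1991 Lemma 4.3 / Gross 1991 Prop. 6.2 (1)
# `c_1(n)_v ∈ δ(E(K_v))` at `v ∤ n` — archimedean clause PROVED, finite clause PROVED on the
# Kodaira–Néron cell and, in general, REDUCED to the Literature fact [GZ86, III (3.1)]

Helper file (`--supports stmt-BirchSwinnertonDyer-21765 --as helper`); it closes nothing and BSD is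
not proved by it.

The hF-free door of this route (`…KolyvaginDepthSupplyDoorOfDatum`, via
`exists_hypothesesDepth_of_classes`) consumes, as hypotheses `hfin` / `hinf` (there fed by the named
leaf `McCallum1991.lemma43_kolyvaginClass_mem_selmerLocalKer` at `M = 1`, "Size M; no `_holds`"), the
local triviality of the concrete class `c_1(n) = d.kolyvaginClass _ 1` at every finite place `v ∤ n`
and at every infinite place. THIS FILE supplies both from tree theorems of other cells that this
route had never imported:

* `kolyvaginClass_mem_selmerLocalKer_infinitePlace` — **the archimedean clause at every level
  `p^M`**: the tree's `mem_selmerLocalKer_infinitePlace_of_isImaginaryQuadratic` (`K_w ≅ ℂ` is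
  algebraically closed, so the local condition is empty; Gross p. 244: *"If `v = ∞`, `K_v = ℂ` is
  algebraically closed and the Galois cohomology of `E` is trivial"*).
* `kolyvaginClass_mem_selmerLocalKer_finite_one_of_hGZ` — the finite clause at level `p` from x11b3's
  `KolyvaginHloc.hloc_concrete_of_GZ31_of_surj` (Gross Prop. 6.2 (1) for the CONCRETE classes at every
  `v ∤ m`: good `v` by Milne *ADT* I.3.8, bad `v` by the `E⁰`-receptacle END), given its receptacle
  clause `hGZ` = [GZ86, III (3.1)] in the per-point form Gross uses it; bridges: Zhang ⟹ Gross primes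
  (`JET.ZhangGross.isKolyvaginPrime_of_zhang`), data at every divisor of `n` through the given datum
  (`nonempty_kolyvaginHeegnerData_of_grossCM` with the two Gross §3 CM facts in their PROVED `_holds`
  form), `(N, d_K) = 1` and `d_K < −4` (x11b3's `KolyvaginAssembly.*`).
* `kolyvaginClass_mem_selmerLocalKer_finite_one_of_kodairaNeron` — **the finite clause at level `p`,
  UNCONDITIONAL on the Kodaira–Néron cell (KN_p)**: `p ∤ ord_v(Δ_min)` at every multiplicative place
  of `E/ℚ` and (only if `p = 3`) no additive place of type IV / IV* — `hGZ` SUPPLIED by x11b3's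
  `KolyvaginHloc.hGZ_of_kodairaNeron_rat` (Tate's algorithm + Néron component groups killed by the
  exponent, the tree's Kodaira–Néron theorems). Every rank-2 curve of prime conductor with
  square-free discriminant is on this cell at every `p ≥ 5`.
* `kolyvaginClass_mem_selmerLocalKer_finite_one_of_gross1991E0` — the finite clause at level `p` in
  general, CONDITIONAL on the named Literature fact
  `Gross1991_heegnerPoint_sub_ratTorsion_mem_E0` (Gross 1991 §6 ⟸ Gross–Zagier 1986 III (3.1):
  Heegner points reduce to `E⁰` up to rational torsion at `v ∣ N`; XL, cite-only), through x11b3's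
  `KolyvaginHloc.hGZ_of_gross1991E0`.
* `lemma43_one_of_gross1991E0` — **the body of the leaf `McCallum1991.lemma43_…` at `M = 1`** from
  that one Literature fact (binders verbatim, `M = 1`).

Net effect for the route: the McCallum-specific leaf `h43` leaves the hypotheses of every level-`p`
door / kit / row; on (KN_p) nothing replaces it, off (KN_p) the standard published input
[GZ86 III (3.1)] (one Literature `def`, shared with the x11b3 / JET programmes) does. Level `p` only
(the tree's Zhang ⟹ Gross bridge is modulo `p`); nothing is asserted about any curve; BSD is not
proved by it.

References: [GrossLMS1991] §6 Prop. 6.2 (1) and proof (pp. 244–245), Lemma 4.3, §3 (3.1)–(3.3);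
[McCallumLMS1991] §4 Lemma 4.3 (p. 301), (4)–(6); [GrossZagier1986] III (3.1); [MilneADT2006]
Ch. I Prop. 3.8; [SilvermanAEC2009] VII.6.1; [WZhang2014] Notations (xii).
-/

set_option linter.dupNamespace false

noncomputable section

open scoped Classical

namespace Summit.BirchSwinnertonDyer.BirchSwinnertonDyer.Theorems.KolyvaginDepthDoor

open Literature.NumberTheory.EllipticCurves Literature.NumberTheory.EllipticCurves.ModularForms
  Literature.NumberTheory.GaloisRepresentations WeierstrassCurve NumberField IsDedekindDomain Field
open Summit.BirchSwinnertonDyer.Rank1Residual.X11b Summit.BirchSwinnertonDyer.Rank1Residual.JET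
open Literature.NumberTheory.DiophantineGeometry (KodairaSymbol)

-- `K : Type`: the tree's ring-class / Zhang–Kolyvagin vocabulary is universe `0`.
variable {K : Type} [Field K] [NumberField K] {W : WeierstrassCurve ℚ}

/-! ## The archimedean clause (every level) -/

/-- The archimedean clause of the leaf for the concrete classes `c_M(n)` of any datum, at every
level `p^M` (the tree's `mem_selmerLocalKer_infinitePlace_of_isImaginaryQuadratic`, file
`HeegnerPointsKolyvaginClassesPointsProofs`: `K_w ≅ ℂ` is algebraically closed).
[cite: McCallumLMS1991, §4 Lemma 4.3 (p. 301)] -/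
theorem kolyvaginClass_mem_selmerLocalKer_infinitePlace {N : ℕ} [NeZero N] (hK : IsImaginaryQuadratic K)
    {Dt : ModularParametrizationData W N} {β : ℤ} {ι : K →+* ℂ} {n : ℕ}
    (d : KolyvaginHeegnerData Dt β ι n) {p : ℕ} (hp : p.Prime) (M : ℕ) (w : InfinitePlace K) :
    d.kolyvaginClass hp M ∈ selmerLocalKer (W.baseChange K) w.Completion ((p ^ M : ℕ) : ℤ) :=
  mem_selmerLocalKer_infinitePlace_of_isImaginaryQuadratic hK _ w _

/-! ## The finite clause at level `p` -/

section Finite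

variable [W.IsElliptic] [W.IsGloballyMinimal] [NeZero (W.conductorNorm ℤ)]

/-- Data at every divisor of a square-free Zhang–Kolyvagin level `n` THROUGH a given datum `d` at `n`
(the other divisors filled by `nonempty_kolyvaginHeegnerData_of_grossCM` with the two Gross §3 CM
facts in their proved `_holds` form), as a dependent family with `family n = d`.
[cite: GrossLMS1991, §3 (pp. 238–239), §4 (4.1)] -/
theorem exists_family_through_datum (hK : IsImaginaryQuadratic K)
    (hH : SatisfiesHeegnerHypothesis (W.conductorNorm ℤ) K)
    (Dt : ModularParametrizationData W (W.conductorNorm ℤ)) (β : ℤ) (ι : K →+* ℂ) {p : ℕ}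
    {n : ℕ} (hn : Squarefree n)
    (hk : ∀ q ∈ n.primeFactors, Zhang2014.IsKolyvaginPrime (W.conductorNorm ℤ) W K p q)
    (d : KolyvaginHeegnerData Dt β ι n) :
    ∃ family : (m : ℕ) → m ∣ n → KolyvaginHeegnerData Dt β ι m, family n dvd_rfl = d := by
  have hCM1 : phi_heegnerPointOfConductor_mem_range_map_ringClassField (W.conductorNorm ℤ) W K :=
    phi_heegnerPointOfConductor_mem_range_map_ringClassField_holds (W.conductorNorm ℤ) W K
  have hCM2 : exists_generator_ringClassGalOver K := exists_generator_ringClassGalOver_holds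
  have hinert : ∀ (m' : ℕ), m' ∣ n → ∀ q ∈ m'.primeFactors, (Ideal.span {(q : 𝓞 K)}).IsPrime :=
    fun m' hm' q hq ↦ (hk q (Nat.primeFactors_mono hm' hn.ne_zero hq)).2.2.2.2.1
  have hne : ∀ m' : ℕ, m' ∣ n → Nonempty (KolyvaginHeegnerData Dt β ι m') := fun m' hm' ↦
    BirchSwinnertonDyer.Theorems.nonempty_kolyvaginHeegnerData_of_grossCM hCM1 hCM2 hK hH Dt β ι
      d.dvd_sq_sub (hn.squarefree_of_dvd hm') (hinert m' hm')
  refine ⟨fun m' hm' ↦ if h : m' = n then h ▸ d else (hne m' hm').some, ?_⟩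
  simp

/-- **Gross 1991 Prop. 6.2 (1) / McCallum Lemma 4.3 at every finite `v ∤ n`, level `p`, for the
concrete class of ANY datum, GIVEN the receptacle clause `hGZ`** ([GZ86, III (3.1)] in the per-point
form Gross uses it, for a family of data through the datum, with its coprimality witness `n'`):
x11b3's `KolyvaginHloc.hloc_concrete_of_GZ31_of_surj` read in the door's currency (`E/ℚ` globally
minimal, `K` imaginary quadratic with `d_K ∉ {−3, −4}` and the Heegner hypothesis for `N_E`, `p` odd
with `ρ̄_{E,p}` onto, `n` square-free with Zhang–Kolyvagin prime factors).
[cite: GrossLMS1991, §6 Prop. 6.2 (1)] [cite: McCallumLMS1991, §4 Lemma 4.3] [cite: GrossZagier1986, III (3.1)] -/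
theorem kolyvaginClass_mem_selmerLocalKer_finite_one_of_hGZ (hK : IsImaginaryQuadratic K)
    (hD3 : NumberField.discr K ≠ -3) (hD4 : NumberField.discr K ≠ -4)
    (hH : SatisfiesHeegnerHypothesis (W.conductorNorm ℤ) K)
    {p : ℕ} [Fact p.Prime] (hp2 : p ≠ 2) (hρ : W.HasSurjectiveModNGaloisRep p)
    (Dt : ModularParametrizationData W (W.conductorNorm ℤ)) (β : ℤ) (ι : K →+* ℂ)
    {n : ℕ} (hn : Squarefree n)
    (hk : ∀ q ∈ n.primeFactors, Zhang2014.IsKolyvaginPrime (W.conductorNorm ℤ) W K p q)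
    (family : (m : ℕ) → m ∣ n → KolyvaginHeegnerData Dt β ι m)
    {n' : ℤ} (hcop : IsCoprime ((p ^ 1 : ℕ) : ℤ) n')
    (hGZ : ∀ (m : ℕ) (hm : m ∣ n) (γ : ringClassField K ι m ≃ₐ[ℚ] ringClassField K ι m),
      γ ∈ ringClassGal ι m → ∀ v : HeightOneSpectrum (𝓞 K), ¬ (W.baseChange K).HasGoodReductionAt v →
        n' • pointsMap (W.baseChange K) (v.adicCompletion K)
            ((family m hm).toGeomPoints (pointGalHom W (ringClassField K ι m) γ (family m hm).y)) ∈
          E0Receptacle (W.baseChange K) v ∧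
        ∀ (ℓ : ℕ) (hℓ : ℓ ∈ m.primeFactors)
          (hle : ringClassField K ι (m / ℓ) ≤ ringClassField K ι m),
          n' • pointsMap (W.baseChange K) (v.adicCompletion K)
              ((family m hm).toGeomPoints (pointGalHom W (ringClassField K ι m) γ
                (WeierstrassCurve.Affine.Point.map (W' := W)
                  ((RingClassField.inclusion ι hle).restrictScalars ℚ)
                  (family (m / ℓ) ((Nat.div_dvd_of_dvd (Nat.dvd_of_mem_primeFactors hℓ)).trans hm)).y))) ∈
            E0Receptacle (W.baseChange K) v)
    (v : HeightOneSpectrum (𝓞 K)) (hv : (n : 𝓞 K) ∉ v.asIdeal) :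
    (family n dvd_rfl).kolyvaginClass (Fact.out : p.Prime) 1 ∈
      selmerLocalKer (W.baseChange K) (v.adicCompletion K) ((p ^ 1 : ℕ) : ℤ) := by
  have hp : p.Prime := Fact.out
  have hKol : ∀ q ∈ n.primeFactors,
      IsKolyvaginPrime (W.conductorNorm ℤ) W K p q ∧ FrobEqFrobInfty W K (p ^ 1) q := fun q hq ↦ by
    have hG := ZhangGross.isKolyvaginPrime_of_zhang W K hK hp2 hρ (hk q hq)
    exact ⟨hG, by rw [pow_one]; exact hG.2.2.2.2.2⟩
  have hND : IsCoprime (W.conductorNorm ℤ : ℤ) (NumberField.discr K) :=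
    KolyvaginAssembly.isCoprime_discr_of_satisfiesHeegnerHypothesis hK hH
  have hD : NumberField.discr K < -4 := KolyvaginAssembly.discr_lt_neg_four hK ⟨hD3, hD4⟩
  exact KolyvaginHloc.hloc_concrete_of_GZ31_of_surj hK ι hp hp2 hρ (M := 1) le_rfl Dt hND hD hn hKol
    family hcop hGZ n dvd_rfl v hv

/-- **LEAF 2, FINITE CLAUSE AT LEVEL `p`, UNCONDITIONAL ON THE KODAIRA–NÉRON CELL (KN_p)**: `E/ℚ`
globally minimal with a modular parametrisation of level `N_E`, `K` imaginary quadratic with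
`d_K ∉ {−3, −4}` and the Heegner hypothesis, `p` odd with `ρ̄_{E,p}` onto, and
(KN_p): `p ∤ ord_v(Δ_min)` at every multiplicative place `v` of `E/ℚ`, and — only when `p = 3` — no
additive place of Kodaira type IV or IV*. Then for every square-free `n` with Zhang–Kolyvagin prime
factors and ANY datum `d` of conductor `n`: `c_1(n) = d.kolyvaginClass _ 1 ∈ δ(E(K_v))` at every
finite `v ∤ n`. Proof: `hGZ` SUPPLIED by x11b3's `KolyvaginHloc.hGZ_of_kodairaNeron_rat`, then
`kolyvaginClass_mem_selmerLocalKer_finite_one_of_hGZ` on a family through `d`.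
[cite: GrossLMS1991, §6 Prop. 6.2 (1)] [cite: McCallumLMS1991, §4 Lemma 4.3]
[cite: SilvermanAEC2009, VII.6.1 (Kodaira–Néron)] -/
theorem kolyvaginClass_mem_selmerLocalKer_finite_one_of_kodairaNeron (hK : IsImaginaryQuadratic K)
    (hD3 : NumberField.discr K ≠ -3) (hD4 : NumberField.discr K ≠ -4)
    (hH : SatisfiesHeegnerHypothesis (W.conductorNorm ℤ) K)
    {p : ℕ} [Fact p.Prime] (hp2 : p ≠ 2) (hρ : W.HasSurjectiveModNGaloisRep p)
    (Dt : ModularParametrizationData W (W.conductorNorm ℤ)) (β : ℤ) (ι : K →+* ℂ)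
    (hmult : ∀ v : HeightOneSpectrum (𝓞 ℚ), W.HasMultiplicativeReductionAt v →
      ¬ p ∣ W.ordMinimalDiscriminant v)
    (hadd : ∀ v : HeightOneSpectrum (𝓞 ℚ), W.HasAdditiveReductionAt v → p ≠ 3 ∨
      (W.kodairaSymbolAt v ≠ KodairaSymbol.IV ∧ W.kodairaSymbolAt v ≠ KodairaSymbol.IVstar))
    {n : ℕ} (hn : Squarefree n)
    (hk : ∀ q ∈ n.primeFactors, Zhang2014.IsKolyvaginPrime (W.conductorNorm ℤ) W K p q)
    (d : KolyvaginHeegnerData Dt β ι n)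
    (v : HeightOneSpectrum (𝓞 K)) (hv : (n : 𝓞 K) ∉ v.asIdeal) :
    d.kolyvaginClass (Fact.out : p.Prime) 1 ∈
      selmerLocalKer (W.baseChange K) (v.adicCompletion K) ((p ^ 1 : ℕ) : ℤ) := by
  have hp : p.Prime := Fact.out
  obtain ⟨family, hfam⟩ := exists_family_through_datum hK hH Dt β ι hn hk d
  have hKol : ∀ q ∈ n.primeFactors,
      IsKolyvaginPrime (W.conductorNorm ℤ) W K p q ∧ FrobEqFrobInfty W K (p ^ 1) q := fun q hq ↦ by
    have hG := ZhangGross.isKolyvaginPrime_of_zhang W K hK hp2 hρ (hk q hq)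
    exact ⟨hG, by rw [pow_one]; exact hG.2.2.2.2.2⟩
  obtain ⟨n', hcop, hGZ⟩ := KolyvaginHloc.hGZ_of_kodairaNeron_rat hK hH ι Dt (β := β) (M := 1) hp
    hp2 hn hKol family hmult hadd
  rw [← hfam]
  exact kolyvaginClass_mem_selmerLocalKer_finite_one_of_hGZ hK hD3 hD4 hH hp2 hρ Dt β ι hn hk family
    hcop hGZ v hv

/-- **LEAF 2, FINITE CLAUSE AT LEVEL `p`, IN GENERAL — from the Literature fact [GZ86, III (3.1)]**
(`Gross1991_heegnerPoint_sub_ratTorsion_mem_E0`: Heegner points reduce into `E⁰` up to rational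
torsion at the places of bad reduction; XL, cite-only, NOT discharged): same conclusion with no
Kodaira–Néron hypothesis, for `E` without CM; `hGZ` supplied by x11b3's
`KolyvaginHloc.hGZ_of_gross1991E0`. [cite: GrossLMS1991, §6 Prop. 6.2 (1) and proof (p. 245)]
[cite: GrossZagier1986, III (3.1)] [cite: McCallumLMS1991, §4 Lemma 4.3] -/
theorem kolyvaginClass_mem_selmerLocalKer_finite_one_of_gross1991E0
    (hE0 : Gross1991_heegnerPoint_sub_ratTorsion_mem_E0) (hcm : ¬ W.HasCM)
    (hK : IsImaginaryQuadratic K) (hD3 : NumberField.discr K ≠ -3) (hD4 : NumberField.discr K ≠ -4)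
    (hH : SatisfiesHeegnerHypothesis (W.conductorNorm ℤ) K)
    {p : ℕ} [Fact p.Prime] (hp2 : p ≠ 2) (hρ : W.HasSurjectiveModNGaloisRep p)
    (Dt : ModularParametrizationData W (W.conductorNorm ℤ)) (β : ℤ) (ι : K →+* ℂ)
    {n : ℕ} (hn : Squarefree n)
    (hk : ∀ q ∈ n.primeFactors, Zhang2014.IsKolyvaginPrime (W.conductorNorm ℤ) W K p q)
    (d : KolyvaginHeegnerData Dt β ι n)
    (v : HeightOneSpectrum (𝓞 K)) (hv : (n : 𝓞 K) ∉ v.asIdeal) :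
    d.kolyvaginClass (Fact.out : p.Prime) 1 ∈
      selmerLocalKer (W.baseChange K) (v.adicCompletion K) ((p ^ 1 : ℕ) : ℤ) := by
  have hp : p.Prime := Fact.out
  obtain ⟨family, hfam⟩ := exists_family_through_datum hK hH Dt β ι hn hk d
  have hKol : ∀ q ∈ n.primeFactors,
      IsKolyvaginPrime (W.conductorNorm ℤ) W K p q ∧ FrobEqFrobInfty W K (p ^ 1) q := fun q hq ↦ by
    have hG := ZhangGross.isKolyvaginPrime_of_zhang W K hK hp2 hρ (hk q hq)
    exact ⟨hG, by rw [pow_one]; exact hG.2.2.2.2.2⟩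
  obtain ⟨n', hcop, hGZ⟩ := KolyvaginHloc.hGZ_of_gross1991E0 hE0 rfl hcm hK ⟨hD3, hD4⟩ hH ι Dt
    (β := β) (M := 1) hp hp2 hρ hn hKol family
  rw [← hfam]
  exact kolyvaginClass_mem_selmerLocalKer_finite_one_of_hGZ hK hD3 hD4 hH hp2 hρ Dt β ι hn hk family
    hcop hGZ v hv

/-- **The body of the leaf `McCallum1991.lemma43_kolyvaginClass_mem_selmerLocalKer` at `M = 1`**
(binder list verbatim, specialised to `M = 1`: the tower hypothesis is used at `n = 1` only, the
index bound `1 ≤ M(ℓ')` is idle), from the ONE Literature fact [GZ86, III (3.1)]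
(`Gross1991_heegnerPoint_sub_ratTorsion_mem_E0`). [cite: McCallumLMS1991, §4 Lemma 4.3 (p. 301)]
[cite: GrossLMS1991, §6 Prop. 6.2 (1)] [cite: GrossZagier1986, III (3.1)] -/
theorem lemma43_one_of_gross1991E0 (hE0 : Gross1991_heegnerPoint_sub_ratTorsion_mem_E0)
    (hcm : ¬ W.HasCM) (hK : IsImaginaryQuadratic K)
    (hD3 : NumberField.discr K ≠ -3) (hD4 : NumberField.discr K ≠ -4)
    (hH : SatisfiesHeegnerHypothesis (W.conductorNorm ℤ) K)
    (p : ℕ) [Fact p.Prime] (hp2 : p ≠ 2) (htower : ∀ n : ℕ, W.HasSurjectiveModNGaloisRep (p ^ n : ℕ))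
    (Dt : ModularParametrizationData W (W.conductorNorm ℤ)) (β : ℤ) (ι : K →+* ℂ)
    (n : ℕ) (hn : Squarefree n)
    (hk : ∀ l' ∈ n.primeFactors, Zhang2014.IsKolyvaginPrime (W.conductorNorm ℤ) W K p l' ∧
      1 ≤ Zhang2014.kolyvaginIndex W p l')
    (d : KolyvaginHeegnerData Dt β ι n) :
    (∀ v : HeightOneSpectrum (𝓞 K), (n : 𝓞 K) ∉ v.asIdeal →
      d.kolyvaginClass (Fact.out : p.Prime) 1 ∈
        selmerLocalKer (W.baseChange K) (v.adicCompletion K) ((p ^ 1 : ℕ) : ℤ)) ∧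
    (∀ w : InfinitePlace K,
      d.kolyvaginClass (Fact.out : p.Prime) 1 ∈
        selmerLocalKer (W.baseChange K) w.Completion ((p ^ 1 : ℕ) : ℤ)) :=
  ⟨fun v hv ↦ kolyvaginClass_mem_selmerLocalKer_finite_one_of_gross1991E0 hE0 hcm hK hD3 hD4 hH hp2
      (by simpa only [pow_one] using htower 1) Dt β ι hn (fun q hq ↦ (hk q hq).1) d v hv,
    fun w ↦ kolyvaginClass_mem_selmerLocalKer_infinitePlace hK d _ 1 w⟩

end Finite

end Summit.BirchSwinnertonDyer.BirchSwinnertonDyer.Theorems.KolyvaginDepthDoor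

end
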